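import Mathlib
import HarnessLib
import Summits.AtomisticToContinuum.BoseEinsteinCondensation.Theses.BECInsertionCorrector
import Literature.MathematicalPhysics.QuantumManyBody.PeriodicBoseGas
import Literature.MathematicalPhysics.QuantumManyBody.WeightedCorrector

/-!
# Sketch — crux-ideate `stmt-AtomisticToContinuum-12058` (`CorrectorClosure`), ideator 2, round 1

First lemmas of three idea cards (they only need to ELABORATE; proofs are `sorry`):

* `residue_ge_of_tilted_variance` — card `geometric-mean-corrector`:
  the convexity sandwich `(E h)² ≥ (E h²)·exp(−sup_{s∈[0,1]} Var_{h^{2s}μ}(log h))`.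
* `cos_arcLength_le_inner` — card `llp-fidelity-arc`: the Fubini–Study arc-length bound
  `cos(∫₀¹ ‖γ'‖) ≤ ⟪γ 0, γ 1⟫` for a `C¹` path of unit vectors.
* `exp_integral_log_sq_le_sq_integral` — card `coupling-entropy-transport`: the Jensen endpoint
  `(E h)² ≥ exp(E log h²)`, i.e. `Z ≥ e^{−H(π‖π₁)}` once `E h² = 1`.

Plus typed SHAPES of the residual statements of cards A and C over the tree vocabulary
(`PeriodicTrialState`, `periodicEnergy`, `periodizedPotential`, `IsWeakCorrector`, `hMinusOneSqW`).
-/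

noncomputable section

open MeasureTheory ProbabilityTheory Real
open scoped ENNReal

namespace Summit.AtomisticToContinuum.BoseEinsteinCondensation.Cruxes.CorrectorClosure.Sketch2

/-! ## Card A — geometric-mean-corrector: convexity sandwich -/

/-- Card A, first lemma. `μ` a probability measure, `h > 0`; `μ_s := h^{2s}·μ / ∫h^{2s}` is
`μ.tilted (2s·log h)`. If `Var_{μ_s}(log h) ≤ V` for all `s ∈ [0,1]` then
`(∫ h)² ≥ e^{-V} ∫ h²` (because `Λ(s) = log ∫ h^{2s} dμ` is convex with `Λ'' = 4 Var_{μ_s}(log h)`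
and `log((∫h²)(∫1)/(∫h)²) = Λ(1) − 2Λ(½) + Λ(0) = 4∫₀¹ min(s,1−s) Var_{μ_s}(log h) ds ≤ V`). -/
theorem residue_ge_of_tilted_variance {Ω : Type*} [MeasurableSpace Ω] (μ : Measure Ω)
    [IsProbabilityMeasure μ] (h : Ω → ℝ) (hmeas : Measurable h) (hpos : ∀ x, 0 < h x)
    (hint : ∀ s ∈ Set.Icc (0 : ℝ) 1,
      Integrable (fun x => h x ^ (2 * s) * (1 + Real.log (h x) ^ 2)) μ)
    (V : ℝ)
    (hvar : ∀ s ∈ Set.Icc (0 : ℝ) 1,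
      variance (fun x => Real.log (h x)) (μ.tilted fun x => 2 * s * Real.log (h x)) ≤ V) :
    Real.exp (-V) * ∫ x, h x ^ 2 ∂μ ≤ (∫ x, h x ∂μ) ^ 2 := by
  sorry

/-- Card A, the exact formula behind the sandwich (same hypotheses): the residue defect is the
`min(s,1-s)`-weighted integral of the tilted variances. -/
theorem log_residue_eq_integral_tilted_variance {Ω : Type*} [MeasurableSpace Ω] (μ : Measure Ω)
    [IsProbabilityMeasure μ] (h : Ω → ℝ) (hmeas : Measurable h) (hpos : ∀ x, 0 < h x)
    (hint : ∀ s ∈ Set.Icc (0 : ℝ) 1,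
      Integrable (fun x => h x ^ (2 * s) * (1 + Real.log (h x) ^ 2)) μ) :
    Real.log ((∫ x, h x ^ 2 ∂μ) / (∫ x, h x ∂μ) ^ 2) =
      4 * ∫ s in (0 : ℝ)..1, min s (1 - s) *
        variance (fun x => Real.log (h x)) (μ.tilted fun x => 2 * s * Real.log (h x)) := by
  sorry

/-! ## Card B — llp-fidelity-arc: Fubini–Study arc length -/

/-- Card B, first lemma (pure Hilbert-space geometry). A `C¹` path of unit vectors whose speed
integrates to `ℓ ≤ π/2` ends at inner product `≥ cos ℓ` with its start ("arc ≥ chord" on the unit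
sphere; with `γ λ` = ground state of `H_N + |P_X|² + λ Σ_j v^per(x_j)` in the Lee–Low–Pines frame,
`‖γ' λ‖² = χ_F(λ)` is the fidelity susceptibility and `⟪γ 0, γ 1⟫² = Z_N`). -/
theorem cos_arcLength_le_inner {E : Type*} [NormedAddCommGroup E] [InnerProductSpace ℝ E]
    (γ γ' : ℝ → E) (hγ : ∀ t ∈ Set.Icc (0 : ℝ) 1, HasDerivAt γ (γ' t) t)
    (hunit : ∀ t ∈ Set.Icc (0 : ℝ) 1, ‖γ t‖ = 1)
    (hcont : ContinuousOn γ' (Set.Icc (0 : ℝ) 1))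
    (hsmall : ∫ t in (0 : ℝ)..1, ‖γ' t‖ ≤ Real.pi / 2) :
    Real.cos (∫ t in (0 : ℝ)..1, ‖γ' t‖) ≤ inner ℝ (γ 0) (γ 1) := by
  sorry

/-! ## Card C — coupling-entropy-transport: Jensen endpoint and the concavity half -/

/-- Card C, first lemma: `(∫ h)² ≥ exp(∫ log h²)` (Jensen). With `∫ h² dμ = 1` and
`μ = π = |Ψ_N|²⊗dy/L³`, `h = Ψ_{N+1}/Ψ_N`, the right side is `e^{-H(π ‖ π₁)}`, `π₁ = |Ψ_{N+1}|²`. -/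
theorem exp_integral_log_sq_le_sq_integral {Ω : Type*} [MeasurableSpace Ω] (μ : Measure Ω)
    [IsProbabilityMeasure μ] (h : Ω → ℝ) (hpos : ∀ x, 0 < h x) (hh : Integrable h μ)
    (hlog : Integrable (fun x => Real.log (h x)) μ) :
    Real.exp (∫ x, Real.log (h x ^ 2) ∂μ) ≤ (∫ x, h x ∂μ) ^ 2 := by
  sorry

/-- Card C, the free half: for a concave `C²` "chemical potential" `m` on `[0,1]`
(`m λ = E₀(H_N − Δ_y + λW) − E_N`, `−m'' /2 = ⟨W̃h_λ, R_λ W̃h_λ⟩` = dressed static response of the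
impurity energy), Cauchy–Schwarz in `λ` gives `∫₀¹ √(−m''/2) ≤ √((m'(0) − m'(1))/2)`, and
`m'(0) − m'(1) = E_π W − E_{π₁} W ≤ ρ‖v‖₁` is an interaction-energy deficit. -/
theorem integral_sqrt_neg_second_deriv_le (m m' m'' : ℝ → ℝ)
    (h1 : ∀ t ∈ Set.Icc (0 : ℝ) 1, HasDerivAt m (m' t) t)
    (h2 : ∀ t ∈ Set.Icc (0 : ℝ) 1, HasDerivAt m' (m'' t) t)
    (hcont : ContinuousOn m'' (Set.Icc (0 : ℝ) 1)) (hconc : ∀ t ∈ Set.Icc (0 : ℝ) 1, m'' t ≤ 0) :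
    ∫ t in (0 : ℝ)..1, Real.sqrt (-m'' t / 2) ≤ Real.sqrt ((m' 0 - m' 1) / 2) := by
  sorry

/-! ## Typed shapes of the residual statements (tree vocabulary)

`Z : Config (N+1)`; particle `0` is the inserted one, `Fin.tail Z` the bath configuration. -/

open Literature.MathematicalPhysics.QuantumManyBody.BoseGas

/-- The impurity–bath interaction `W(y,X) = Σ_j v^per(y − x_j)` of the inserted particle (real
value; `⊤` is sent to `0` by `toReal`, harmless for soft `v`). -/
def impurityPotential {N : ℕ} (v : ℝ → ℝ≥0∞) (L : ℝ) (Z : Config (N + 1)) : ℝ :=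
  ∑ j : Fin N, (periodizedPotential v L (Z 0 - Z j.succ)).toReal

/-- The insertion log-amplitude `ψ = −log h`, `h = |Ψ|/|Θ ∘ tail|`. -/
def insertionLogAmplitude {N : ℕ} {L : ℝ} (Θ : PeriodicTrialState N L)
    (Ψ : PeriodicTrialState (N + 1) L) (Z : Config (N + 1)) : ℝ :=
  -Real.log (‖Ψ.ψ Z‖ / ‖Θ.ψ (Fin.tail Z)‖)

/-- The geometric-mean (half-tilt) weight `F_{1/2} = (|Θ ∘ tail|·|Ψ|)^{1/2}`, whose square is the
mixed density `Ψ_N Ψ_{N+1}`. -/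
def geometricMeanWeight {N : ℕ} {L : ℝ} (Θ : PeriodicTrialState N L)
    (Ψ : PeriodicTrialState (N + 1) L) (Z : Config (N + 1)) : ℝ :=
  Real.sqrt (‖Θ.ψ (Fin.tail Z)‖ * ‖Ψ.ψ Z‖)

/-- Card A, residual identity (shape). HALF-TILT CORRECTOR IDENTITY: if `Θ ≥ 0` and `Ψ > 0` are
`C²` periodic states ATTAINING the `N`- and `(N+1)`-body periodic ground-state energies on the same
torus, then `ψ = −log(Ψ/Θ)` is a weak corrector of `W − μ_N`, `μ_N = E₀(N+1) − E₀(N)`, for the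
weight `F_{1/2}`:  `−𝓛_{1/2} ψ = W − μ_N`, i.e. `IsWeakCorrector L F_{1/2} (W − μ_N) ψ`
(Γ-calculus: `𝓛₀ψ = μ − W + |∇ψ|²` and `𝓛_{1/2} = 𝓛₀ − ∇ψ·∇`). -/
def HalfTiltCorrectorIdentity : Prop :=
  ∀ (v : ℝ → ℝ≥0∞) (N : ℕ) (L : ℝ), 0 < L →
  ∀ (Θ : PeriodicTrialState N L) (Ψ : PeriodicTrialState (N + 1) L),
    (∀ X, Θ.ψ X = (‖Θ.ψ X‖ : ℂ) ∧ 0 < ‖Θ.ψ X‖) → (∀ Z, Ψ.ψ Z = (‖Ψ.ψ Z‖ : ℂ) ∧ 0 < ‖Ψ.ψ Z‖) →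
    ContDiff ℝ 2 Θ.ψ → ContDiff ℝ 2 Ψ.ψ →
    periodicEnergy v Θ = periodicGroundStateEnergy v N L →
    periodicEnergy v Ψ = periodicGroundStateEnergy v (N + 1) L →
    periodicEnergy v Ψ ≠ ⊤ →
    IsWeakCorrector L (geometricMeanWeight Θ Ψ)
      (fun Z => impurityPotential v L Z -
        ((periodicGroundStateEnergy v (N + 1) L).toReal - (periodicGroundStateEnergy v N L).toReal))
      (insertionLogAmplitude Θ Ψ)

/-- Card C, residual statement (shape). DRESSED TRANSPORT BOUND: along the impurity-coupling path
`λ ∈ [0,1]`, if `Φ` (positive, `C¹`, periodic, normalised on the cell) minimises the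
`(N+1)`-body energy with the inserted particle coupled at strength `λ`, then the Kipnis–Varadhan
`H₋₁(|Φ|²)` norm of the density ratio `dπ/dπ_λ − 1 = |Θ∘tail|²/(L³|Φ|²) − 1` is bounded by `D`,
uniformly (the planner's `D_λ ≤ D`; together with `exp_integral_log_sq_le_sq_integral` and
`integral_sqrt_neg_second_deriv_le` it gives `Z_N ≥ exp(−D √(2ρ‖v‖₁))`). The λ-energy is written
out over `Config (N+1)` without Bose symmetry in the inserted coordinate. -/
def coupledEnergy {N : ℕ} (v : ℝ → ℝ≥0∞) (L lam : ℝ) (Φ : Config (N + 1) → ℂ) : ℝ≥0∞ :=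
  ∫⁻ Z in cellN (N + 1) L, kineticDensity Φ Z +
    (periodicInteraction v L (Fin.tail Z) +
      ENNReal.ofReal lam * ∑ j : Fin N, periodizedPotential v L (Z 0 - Z j.succ)) *
        (‖Φ Z‖₊ : ℝ≥0∞) ^ 2

/-- See `coupledEnergy`. -/
def DressedTransportBound (v : ℝ → ℝ≥0∞) (ρ D : ℝ) : Prop :=
  ∀ᶠ N : ℕ in Filter.atTop, ∀ lam ∈ Set.Icc (0 : ℝ) 1,
    ∀ (Θ : PeriodicTrialState N (sideLength ρ (N + 1))) (Φ : Config (N + 1) → ℂ),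
      let L := sideLength ρ (N + 1)
      (∀ X, Θ.ψ X = (‖Θ.ψ X‖ : ℂ) ∧ 0 < ‖Θ.ψ X‖) →
      periodicEnergy v Θ = periodicGroundStateEnergy v N L →
      ContDiff ℝ 1 Φ → (∀ Z, Φ Z = (‖Φ Z‖ : ℂ) ∧ 0 < ‖Φ Z‖) →
      (∀ (Z : Config (N + 1)) (i : Fin (N + 1)) (k : Fin 3),
        Φ (Z + Pi.single i (EuclideanSpace.single k L)) = Φ Z) →
      (∫⁻ Z in cellN (N + 1) L, (‖Φ Z‖₊ : ℝ≥0∞) ^ 2) = 1 →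
      (∀ Φ' : Config (N + 1) → ℂ, ContDiff ℝ 1 Φ' →
        (∀ (Z : Config (N + 1)) (i : Fin (N + 1)) (k : Fin 3),
          Φ' (Z + Pi.single i (EuclideanSpace.single k L)) = Φ' Z) →
        (∫⁻ Z in cellN (N + 1) L, (‖Φ' Z‖₊ : ℝ≥0∞) ^ 2) = 1 →
        coupledEnergy v L lam Φ ≤ coupledEnergy v L lam Φ') →
      hMinusOneSqW L (fun Z => ‖Φ Z‖)
        (fun Z => ‖Θ.ψ (Fin.tail Z)‖ ^ 2 / (L ^ 3 * ‖Φ Z‖ ^ 2) - 1) ≤ ENNReal.ofReal D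

/-- Card B, typed objects. LEE–LOW–PINES ENERGY of an `N`-body periodic function: the periodic
`N`-body energy plus the recoil form `|P_X Φ|² = |Σ_j ∇_j Φ|²` plus a static impurity `λ v^per` at
the origin. Its ground state at `λ = 1` is the zero-slice `X ↦ Ψ_{N+1}(0, X)` of the
`(N+1)`-body ground state (translation invariance), at `λ = 0` it is `Ψ_N` itself (`P_X Ψ_N = 0`). -/
def llpEnergy {N : ℕ} (v : ℝ → ℝ≥0∞) (L lam : ℝ) (Φ : Config N → ℂ) : ℝ≥0∞ :=
  ∫⁻ X in cellN N L, kineticDensity Φ X +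
    (∑ k : Fin 3, (‖∑ j : Fin N, fderiv ℝ Φ X (Pi.single j (EuclideanSpace.single k (1 : ℝ)))‖₊ :
      ℝ≥0∞) ^ 2) +
    (periodicInteraction v L X + ENNReal.ofReal lam * ∑ j : Fin N, periodizedPotential v L (X j)) *
      (‖Φ X‖₊ : ℝ≥0∞) ^ 2

/-- The zero-slice `X ↦ Ψ(0, X)` of an `(N+1)`-body function (inserted particle put at the origin). -/
def zeroSlice {N : ℕ} (Ψ : Config (N + 1) → ℂ) (X : Config N) : ℂ :=
  Ψ (Matrix.vecCons 0 X)

/-- Card B, identity (shape). RESIDUE = SLICE OVERLAP: for translation-invariant `Θ` (N bodies) and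
`Ψ` (N+1 bodies) on the torus of side `L`, the insertion-residue quantity of `InsertionResidue`
equals `|⟨Θ, Ψ(0,·)⟩|² / ‖Ψ(0,·)‖²` — a ground-state FIDELITY in the Lee–Low–Pines frame. -/
def ResidueEqSliceOverlap : Prop :=
  ∀ (N : ℕ) (L : ℝ), 0 < L → ∀ (Θ : PeriodicTrialState N L) (Ψ : PeriodicTrialState (N + 1) L),
    (∀ (s : Space) (X : Config N), Θ.ψ (fun j => X j + s) = Θ.ψ X) →
    (∀ (s : Space) (Z : Config (N + 1)), Ψ.ψ (fun j => Z j + s) = Ψ.ψ Z) →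
    ENNReal.ofReal ((L ^ 3)⁻¹) *
        (‖∫ X in cellN N L, (starRingEnd ℂ) (Θ.ψ X) * ∫ x in cell L, Ψ.ψ (Matrix.vecCons x X)‖₊ :
          ℝ≥0∞) ^ 2 =
      (‖∫ X in cellN N L, (starRingEnd ℂ) (Θ.ψ X) * zeroSlice Ψ.ψ X‖₊ : ℝ≥0∞) ^ 2 /
        ∫⁻ X in cellN N L, (‖zeroSlice Ψ.ψ X‖₊ : ℝ≥0∞) ^ 2

/-- Card B, variational principle (shape). The LLP energy at `λ = 1` is bounded below by the
`(N+1)`-body periodic ground-state energy on normalised bath-symmetric periodic `C¹` functions, and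
the zero-slice of a state attaining `E₀(N+1)` attains it (so the slice IS the LLP ground state). -/
def LLPVariationalPrinciple : Prop :=
  ∀ (v : ℝ → ℝ≥0∞) (N : ℕ) (L : ℝ), 0 < L →
    (∀ Φ : PeriodicTrialState N L,
        periodicGroundStateEnergy v (N + 1) L ≤ llpEnergy v L 1 Φ.ψ) ∧
    ∀ Ψ : PeriodicTrialState (N + 1) L,
      (∀ (s : Space) (Z : Config (N + 1)), Ψ.ψ (fun j => Z j + s) = Ψ.ψ Z) →
      periodicEnergy v Ψ = periodicGroundStateEnergy v (N + 1) L →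
      llpEnergy v L 1 (zeroSlice Ψ.ψ) =
        periodicGroundStateEnergy v (N + 1) L * ∫⁻ X in cellN N L, (‖zeroSlice Ψ.ψ X‖₊ : ℝ≥0∞) ^ 2

/-- Card C as an implication shape toward the crux: static response ⇒ dressed transport bound ⇒
insertion residue (the second arrow is cards C's Jensen + concavity chain). -/
def CouplingEntropyTransportLine : Prop :=
  (∀ v : ℝ → ℝ≥0∞, IsRepulsiveFiniteRange v → ∃ ρ₀ : ℝ, 0 < ρ₀ ∧ ∀ ρ : ℝ, 0 < ρ → ρ < ρ₀ →
      ∃ D : ℝ, DressedTransportBound v ρ D) →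
    Summit.AtomisticToContinuum.BoseEinsteinCondensation.Theses.BECInsertionCorrector.InsertionResidue

end Summit.AtomisticToContinuum.BoseEinsteinCondensation.Cruxes.CorrectorClosure.Sketch2
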